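import Summits.Ventures.Crystal3D.Theorems.StickyWulffConstantCoaxialWallLawTailResidueDefs3
import Summits.Ventures.Crystal3D.Theorems.StickyWulffConstantCoaxialWallLawReadingDirectionsApex
import HarnessLib

/-!
# Definitions L: POSITION-BASED LENS TYPES (apex balls by fine coordinates, no hosts) — the type language of record
# (crux `CoaxialWallLaw`, stmt-Ventures-19481; cf-p1 DECISION (cxi); supersedes the host-based `ResidueType₃` of `…TailResidueDefs3`)

HONEST FRAMING. Venture `Summits/Ventures/Crystal3D` (cell `crystal3d-full`); DEFINITIONS ONLY for the crux `CoaxialWallLaw`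
(stmt-Ventures-19481, `route-Ventures-StickyWulffConstant`), registered line 'CoaxialWallLawCertificates' (planner cf-p1).  Nothing is
claimed; F-C1 not moved.  WHY A THIRD TEXT: `…TailResidueDefs3` describes a rigid (apex) filler by a HOST `(y, a, b, up)` with `y ∈ occ`,
`dsq12 0 y ≤ 48`; but an apex ball inside the window `B̄(0,3)` can have all three hosts farther than `2` — or outside the window, or
unoccupied — while still touching an exact pool payer; such a ball is then neither typable as rigid (no admissible host) nor as loose (it
sits at an apex position, violating the witness clause), and omitting it under-counts a decorated degree (unsound).  The repair is to
describe apex balls by POSITION: the functional reads positions only (`position_of_stdFrame`: standard readers read module sites and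
first-generation apex positions), so «exact» = at a module site or at an off-module first-generation apex position of the window,
occupied hosts or not.  Contents (namespace `TailResidue`):
* `addI`, `siteBox4`, `apexSides` (adjacent menu pair × side with OFF-module apex vector), **`apexBall`** — the fine coordinates of all
  off-module first-generation apex positions within `3` of the payer (`dotI ≤ 1458`; 5 724 points), decidable data;
* `HostRefL` (site | apex position | junction site), **`LensType {occ, apex : Finset, loose : List (Finset HostRefL), junction}`**,
  `LensType.ValidHost`, `HostRefL.Near`, **`LensType.WellFormed`** (data conditions only: `occ ⊆ siteBall`, payer occupied with `≤ 11` menu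
  contacts, `dsq12 ≥ 12`, `apex ⊆ apexBall`, loose host sets non-empty / valid / one host within `2`; NO counts, NO credit);
* `LensType.hostPoint`, `LensType.realise`, `LensType.looseAt`, **`LensType.Realisable`** (exact balls `1`-separated; JOINT loose witnesses:
  off the module, at no point of `apexBall`, at distance `1` from their hosts, `> 1` from the other exact balls, pairwise `≥ 1`);
* **`LensType.row`** (`localSummandFlatDecL` of `…Defs3`: decorated degrees, NO filler credit, two-payer clause over exact contacts),
  **`LensCert s`**, **`LensSoundness`** — the finite fact and the T4 target of record; `…TailResidueClosingL` closes the crux on them.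
WHAT THIS IS NOT: any statement about packings; F-C1 not moved.
-/

noncomputable section

namespace Summit.Ventures.Crystal3D.Theorems

namespace TailResidue

open Summit.Ventures.Crystal3D Finset
open scoped InnerProductSpace

/-! ### The apex positions of the window (decidable data) -/

/-- Componentwise sum of integer triples. -/
def addI (s t : ℤ × ℤ × ℤ) : ℤ × ℤ × ℤ := (s.1 + t.1, s.2.1 + t.2.1, s.2.2 + t.2.2)

/-- The sites within `4` of the payer (`dsq12 ≤ 192`; hosts of apex positions within `3`). -/
def siteBox4 : Finset (ℤ × ℤ × ℤ) :=
  ((Icc (-10 : ℤ) 10) ×ˢ ((Icc (-13 : ℤ) 13) ×ˢ (Icc (-4 : ℤ) 4))).filter fun s => dsq12 (0, 0, 0) s ≤ 192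

/-- Adjacent menu pairs with a side whose apex vector is OFF the module (`apexFine ∉ siteFine '' menu`; `72` of the `168`). -/
def apexSides : Finset (((ℤ × ℤ × ℤ) × (ℤ × ℤ × ℤ)) × Bool) :=
  (menuPairs ×ˢ (Finset.univ : Finset Bool)).filter fun p => apexFine p.1.1 p.1.2 p.2 ∉ menuOffsets.image siteFine

/-- **THE APEX POSITIONS OF THE WINDOW**: fine coordinates `siteFine q + apexFine a b up` of the off-module first-generation apex positions
over sites `q` within `4`, restricted to the window `B̄(0, 3)` (`dotI ≤ 1458 = 162·9`). -/
def apexBall : Finset (ℤ × ℤ × ℤ) :=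
  ((siteBox4 ×ˢ apexSides).image fun p => addI (siteFine p.1) (apexFine p.2.1.1 p.2.1.2 p.2.2)).filter fun F => dotI F F ≤ 1458

/-! ### Position-based lens types -/

/-- A host of a loose filler: a module site, an apex position (fine coordinates), or a site of the reflected (junction) grain. -/
inductive HostRefL
  | site (s : ℤ × ℤ × ℤ)
  | apex (F : ℤ × ℤ × ℤ)
  | junc (s : ℤ × ℤ × ℤ)
  deriving DecidableEq

/-- **LENS TYPE (position-based)**: occupied module sites, occupied apex positions, loose fillers as host sets (any number), junction. -/
structure LensType where
  /-- occupied sites of the module core -/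
  occ : Finset (ℤ × ℤ × ℤ)
  /-- occupied off-module first-generation apex positions (fine coordinates) -/
  apex : Finset (ℤ × ℤ × ℤ)
  /-- loose fillers: their host sets -/
  loose : List (Finset HostRefL)
  /-- junction datum: mirror index, plane site, occupied sites of the second grain (preimage sites) -/
  junction : Option (Fin 6 × (ℤ × ℤ × ℤ) × Finset (ℤ × ℤ × ℤ))
  deriving DecidableEq

/-- A host reference is VALID for the type. -/
def LensType.ValidHost (τ : LensType) : HostRefL → Prop
  | .site s => s ∈ τ.occ
  | .apex F => F ∈ τ.apex
  | .junc s => match τ.junction with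
    | none => False
    | some J => s ∈ J.2.2

/-- A host reference is NEAR the payer (within `2`): the relevance filter for loose fillers. -/
def HostRefL.Near : HostRefL → Prop
  | .site s => dsq12 (0, 0, 0) s ≤ 48
  | .apex F => dotI F F ≤ 648
  | .junc _ => True

/-- **Well-formedness (position-based)**: decidable data conditions only. -/
def LensType.WellFormed (τ : LensType) : Prop :=
  τ.occ ⊆ siteBall ∧ ((0, 0, 0) : ℤ × ℤ × ℤ) ∈ τ.occ ∧ (∀ s ∈ τ.occ, ∀ t ∈ τ.occ, s ≠ t → 12 ≤ dsq12 s t) ∧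
    (τ.occ.filter fun s => dsq12 (0, 0, 0) s = 12).card ≤ 11 ∧ τ.apex ⊆ apexBall ∧
    (∀ H ∈ τ.loose, 1 ≤ H.card ∧ (∀ h ∈ H, τ.ValidHost h) ∧ ∃ h ∈ H, h.Near) ∧
    (match τ.junction with
      | none => True
      | some J => J.2.2 ⊆ siteBall ∧ J.2.1 ∈ siteBall)

/-! ### Realisation -/

/-- The point of a host reference. -/
def LensType.hostPoint (τ : LensType) : HostRefL → EuclideanSpace ℝ (Fin 3)
  | .site s => modSite s
  | .apex F => fineVec F
  | .junc s => match τ.junction with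
    | none => modSite s
    | some J => reflectAt (inclinedNormal J.1) (modSite J.2.1) (modSite s)

/-- The exact balls: occupied sites, occupied apex positions, and (if any) the reflected second grain. -/
def LensType.realise (τ : LensType) : Finset (EuclideanSpace ℝ (Fin 3)) :=
  τ.occ.image modSite ∪ τ.apex.image fineVec ∪
    (match τ.junction with
      | none => ∅
      | some J => J.2.2.image fun s => reflectAt (inclinedNormal J.1) (modSite J.2.1) (modSite s))

open scoped Classical in
/-- The number of loose fillers hosted by the exact ball at `y`. -/
def LensType.looseAt (τ : LensType) (y : EuclideanSpace ℝ (Fin 3)) : ℕ :=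
  (τ.loose.filter fun H => y ∈ H.image τ.hostPoint).length

/-- **Realisability (position-based)**: exact balls `1`-separated, and a JOINT system of loose witnesses — each off the module, at no apex
position of the window, at distance `1` from its hosts, `> 1` from every other exact ball — pairwise `≥ 1` apart. -/
def LensType.Realisable (τ : LensType) : Prop :=
  (∀ p ∈ τ.realise, ∀ q ∈ τ.realise, p ≠ q → (1 : ℝ) ≤ dist p q) ∧
  ∃ ξ : ℕ → EuclideanSpace ℝ (Fin 3),
    (∀ i : ℕ, ∀ H : Finset HostRefL, τ.loose[i]? = some H →
      ξ i ∉ coaxialModule 1 (Real.sqrt (2 / 3)) ∧ (∀ F ∈ apexBall, ξ i ≠ fineVec F) ∧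
      (∀ h ∈ H, dist (ξ i) (τ.hostPoint h) = 1) ∧ (∀ p ∈ τ.realise, p ∉ H.image τ.hostPoint → 1 < dist (ξ i) p)) ∧
    (∀ i j : ℕ, i ≠ j → i < τ.loose.length → j < τ.loose.length → (1 : ℝ) ≤ dist (ξ i) (ξ j))

/-! ### The row, the finite fact and the soundness target (of record) -/

/-- **The JOINT row of a lens type** at the placement `L₀`: `localSummandFlatDecL` (decorated degrees `looseAt`, NO filler credit,
two-payer clause over exact deficient contacts). -/
def LensType.row (τ : LensType) (L₀ : EuclideanSpace ℝ (Fin 3) ≃ₗᵢ[ℝ] EuclideanSpace ℝ (Fin 3)) : ℝ :=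
  localSummandFlatDecL WordVersion.v2 (basalSystem L₀)
    (basalSystem (((ℝ ∙ EuclideanSpace.single (2 : Fin 3) (1 : ℝ)).reflection).trans L₀)) τ.realise τ.looseAt 0

/-- **THE LENS CERTIFICATE at the line `s`** (finite fact of record): every well-formed realisable lens type has `row ≤ s` at every standard
placement.  Instance of record `s = 2√6`. -/
def LensCert (s : ℝ) : Prop :=
  ∀ τ : LensType, τ.WellFormed → τ.Realisable →
    ∀ L₀ : EuclideanSpace ℝ (Fin 3) ≃ₗᵢ[ℝ] EuclideanSpace ℝ (Fin 3), StdFrame L₀ → τ.row L₀ ≤ s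

open scoped Classical in
/-- **LENS SOUNDNESS (THE T4 TARGET of record)**: at every payer window of a `1`-separated configuration that is NOT on-site for 𝒰_cx,
either a deletion of inessential balls lands on-site, or the JOINT summand of the frame `L` is bounded by the row of some well-formed
realisable lens type at some standard placement. -/
def LensSoundness : Prop :=
  ∀ L : EuclideanSpace ℝ (Fin 3) ≃ₗᵢ[ℝ] EuclideanSpace ℝ (Fin 3),
  ∀ X : Finset (EuclideanSpace ℝ (Fin 3)), (∀ p ∈ X, ∀ q ∈ X, p ≠ q → 1 ≤ dist p q) →
  ∀ z ∈ X, (X.filter fun q => dist z q = 1).card ≤ 11 → ¬ OnSiteAt coaxialModuleUniverse X z →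
    HasDeletionOnSite X z ∨ ∃ τ : LensType, τ.WellFormed ∧ τ.Realisable ∧
      ∃ L₀ : EuclideanSpace ℝ (Fin 3) ≃ₗᵢ[ℝ] EuclideanSpace ℝ (Fin 3), StdFrame L₀ ∧
        localSummandA WordVersion.v2 (basalSystem L)
          (basalSystem (((ℝ ∙ EuclideanSpace.single (2 : Fin 3) (1 : ℝ)).reflection).trans L)) X z ≤ τ.row L₀

end TailResidue

end Summit.Ventures.Crystal3D.Theorems

end
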